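import Summits.Ventures.DiscreteObjects.PP12.FlagTenPhiInjective
import Summits.Ventures.DiscreteObjects.PP12.FlagTenOrbitMatrix

/-!
# The `f = 10` flag-cell orbit data transported to `Fin` types: the `FlagTenOrbitData` of a plane (kernel; Step E skeleton)
Framing: lottery ticket; floor = certified bounds/negative ranges.

Cell pub-namedobj (venture DiscreteObjects), target (M), designs gen 13 (HOME FAMILY-FLAG7X §7/§7b). Given the `f = 10` flag setting and a
non-fixed line `u₀ ∋ c`, this file DEFINES `flagTenDataOfPlane : FlagTenOrbitData` (designs g12's structure, p322607) from the plane: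
the index types `{x ∈ u₀, x ≠ c}` (12), fixed lines `≠ l` (9), fixed points `≠ c` (9), orbits on a fixed line / line orbits through a fixed
point (4 each, `FlagTenIndexSets`) are identified with `Fin 12 / Fin 9 / Fin 4` by `Fintype.equivFinOfCardEq`, `φ` is the permutation
induced by `phiVertex` (`phiVertex_injective`), and `γ, C, β` are `gammaOrb, cOrb, betaOrb` (`FlagTenOrbitDataOfPlane`; `betaOrb_mem` here).
What remains for `FlagTenOrbitReduction` is to prove `IsFlagTenOrbitMatrix flagTenDataOfPlane`: conjuncts 1–4 are available at subtype level
(`phiVertex_spec`, `phiVertex_no_two_cycle`, `phiVertex_injective`, `card_gammaOrb_fibre`, `gammaOrb_phiVertex_ne`, `card_cOrb_fibre`,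
`cOrb_phiVertex_ne`, `betaOrb_injective`) and need only transport; conjuncts 5–10 are the six λ = 1 equations (FAMILY-FLAG7X §7b).
No `sorry`, no new axioms.
-/

namespace Summit.Ventures.DiscreteObjects.PP12

open Configuration Finset
open scoped Classical

namespace Collineation

variable {P L : Type*} [Membership P L] [ProjectivePlane P L] [Fintype P] [Fintype L] (σ : Collineation P L)

section Flag

variable {l : L} {c : P} (hl : σ.onLines l = l) (hc : σ.onPoints c = c) (hcl : c ∈ l)
  (hP : ∀ p : P, σ.onPoints p = p → p ∈ l) (hL : ∀ m : L, σ.onLines m = m → c ∈ m)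
  (h12 : ProjectivePlane.order P L = 12)

include hc hcl hP hL in
/-- `β` lands in the orbit set of `m`: for a T-line `b ∋ y` (`y ≠ c` fixed, `b ≠ l`) and a fixed line `m ≠ l`,
`betaOrb m (orb3 b)` is one of the orbits of the points `≠ c` of `m`. -/
theorem betaOrb_mem (hq : σ.onPoints ^ 3 = 1) {y : P} (hy : σ.onPoints y = y) (hyc : y ≠ c) {b : L} (hyb : y ∈ b) (hbl : b ≠ l)
    {m : L} (hm : σ.onLines m = m) (hml : m ≠ l) :
    σ.betaOrb c m (orb3 σ.onLines b) ∈ (univ.filter fun p : P => p ∈ m ∧ p ≠ c).image (orb3 σ.onPoints) := by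
  have hcb : c ∉ b := σ.c_not_mem_tline hcl hP hy hyc hyb hbl
  rw [σ.betaOrb_eq hc hL hq hm hcb (self_mem_orb3 _ _)]
  obtain ⟨w, hwb, hwm, -, hwc, huniq⟩ := σ.tline_inter_fixedLine hcl hP hL hy hyc hyb hbl hm hml
  have hbm : b ≠ m := fun e => hcb (e ▸ hL m hm)
  have : meetPt c b m = w := huniq _ (meetPt_spec c hbm).1 (meetPt_spec c hbm).2
  rw [this]
  exact mem_image.2 ⟨w, mem_filter.2 ⟨mem_univ _, hwm, hwc⟩, rfl⟩

/-! ### The indexing equivalences -/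

variable (l c)

/-- triangle index: points `≠ c` of the chosen c-line `u₀` -/
abbrev TriIdx (u₀ : L) : Type _ := {x : P // x ∈ u₀ ∧ x ≠ c}
/-- fixed lines `≠ l` -/
abbrev FixLIdx : Type _ := {m : L // σ.onLines m = m ∧ m ≠ l}
/-- fixed points `≠ c` -/
abbrev FixPIdx : Type _ := {y : P // σ.onPoints y = y ∧ y ≠ c}
/-- orbits of the points `≠ c` of a line `m` -/
abbrev OrbOn (m : L) : Type _ := ((univ.filter fun p : P => p ∈ m ∧ p ≠ c).image (orb3 σ.onPoints) : Finset (Finset P))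
/-- line orbits `≠ l` through a point `y` -/
abbrev LOrbThrough (y : P) : Type _ := ((univ.filter fun b : L => y ∈ b ∧ b ≠ l).image (orb3 σ.onLines) : Finset (Finset L))

variable {l c}

include h12 in
/-- `Fin 12 ≃` triangle index. -/
theorem card_triIdx {u₀ : L} (hcu₀ : c ∈ u₀) : Fintype.card (TriIdx (P := P) c u₀) = 12 := by
  rw [Fintype.card_subtype]; exact card_points_ne_on_line_eq_twelve h12 hcu₀

include hl hc in
/-- `Fin 9 ≃` fixed lines `≠ l` (`f = 10`). -/
theorem card_fixLIdx (hf : fixedCard σ.onPoints = 10) : Fintype.card (σ.FixLIdx l) = 9 := by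
  rw [Fintype.card_subtype]; exact (σ.card_fixed_ne_eq_nine hf hl hc).1

include hl hc in
/-- `Fin 9 ≃` fixed points `≠ c` (`f = 10`). -/
theorem card_fixPIdx (hf : fixedCard σ.onPoints = 10) : Fintype.card (σ.FixPIdx c) = 9 := by
  rw [Fintype.card_subtype]; exact (σ.card_fixed_ne_eq_nine hf hl hc).2

include hc hcl hP hL h12 in
/-- `Fin 4 ≃` orbits on a fixed line `m ≠ l`. -/
theorem card_orbOn (hq : σ.onPoints ^ 3 = 1) {m : L} (hm : σ.onLines m = m) (hml : m ≠ l) : Fintype.card (σ.OrbOn c m) = 4 := by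
  rw [Fintype.card_coe]; exact σ.card_orbits_on_fixedLine_eq_four hc hcl hP hL h12 hq hm hml

include hl hcl hP hL h12 in
/-- `Fin 4 ≃` line orbits `≠ l` through a fixed point `y ≠ c`. -/
theorem card_lOrbThrough (hq : σ.onPoints ^ 3 = 1) {y : P} (hy : σ.onPoints y = y) (hyc : y ≠ c) :
    Fintype.card (σ.LOrbThrough l y) = 4 := by
  rw [Fintype.card_coe]; exact σ.card_lineOrbits_through_fixedPoint_eq_four hl hcl hP hL h12 hq hy hyc

/-! ### The data (named pieces, so that the conjunct proofs can unfold them) -/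

section Data

variable (hl : σ.onLines l = l) (hc : σ.onPoints c = c) (hcl : c ∈ l)
  (hP : ∀ p : P, σ.onPoints p = p → p ∈ l) (hL : ∀ m : L, σ.onLines m = m → c ∈ m) (h12 : ProjectivePlane.order P L = 12)
  (hq : σ.onPoints ^ 3 = 1) (hf : fixedCard σ.onPoints = 10) {u₀ : L} (hcu₀ : c ∈ u₀) (hu₀ : σ.onLines u₀ ≠ u₀)

/-- `Fin 12 ≃` the triangle index. -/
noncomputable def eTri : Fin 12 ≃ TriIdx (P := P) c u₀ := (Fintype.equivFinOfCardEq (card_triIdx (P := P) h12 hcu₀)).symm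
/-- `Fin 9 ≃` fixed lines `≠ l`. -/
noncomputable def eFixL : Fin 9 ≃ σ.FixLIdx l := (Fintype.equivFinOfCardEq (σ.card_fixLIdx hl hc hf)).symm
/-- `Fin 9 ≃` fixed points `≠ c`. -/
noncomputable def eFixP : Fin 9 ≃ σ.FixPIdx c := (Fintype.equivFinOfCardEq (σ.card_fixPIdx hl hc hf)).symm
/-- `Fin 4 ≃` orbits on the fixed line `m`. -/
noncomputable def eOrbOn (m : σ.FixLIdx l) : Fin 4 ≃ σ.OrbOn c m.1 :=
  (Fintype.equivFinOfCardEq (σ.card_orbOn hc hcl hP hL h12 hq m.2.1 m.2.2)).symm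
/-- `Fin 4 ≃` line orbits through the fixed point `y`. -/
noncomputable def eLOrb (y : σ.FixPIdx c) : Fin 4 ≃ σ.LOrbThrough l y.1 :=
  (Fintype.equivFinOfCardEq (σ.card_lOrbThrough hl hcl hP hL h12 hq y.2.1 y.2.2)).symm

/-- `φ` on the triangle index (well defined by `phiVertex_spec`). -/
noncomputable def phiTri (x : TriIdx (P := P) c u₀) : TriIdx (P := P) c u₀ :=
  ⟨σ.phiVertex l c u₀ x.1, (σ.phiVertex_spec hl hc hcl hP hL h12 hq hf hcu₀ hu₀ (σ.exterior_of_mem_cline hL hcu₀ hu₀ x.2.1 x.2.2)).1,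
    (σ.phiVertex_spec hl hc hcl hP hL h12 hq hf hcu₀ hu₀ (σ.exterior_of_mem_cline hL hcu₀ hu₀ x.2.1 x.2.2)).2.1⟩

/-- `phiTri` is injective (`phiVertex_injective`). -/
theorem phiTri_injective : Function.Injective (σ.phiTri hl hc hcl hP hL h12 hq hf hcu₀ hu₀) := fun x₁ x₂ h =>
  Subtype.ext (σ.phiVertex_injective hl hc hcl hP hL h12 hq hf hcu₀ hu₀ x₁.2.1 x₁.2.2 x₂.2.1 x₂.2.2 (congrArg Subtype.val h))

/-- `φ` as a permutation of the triangle index. -/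
noncomputable def phiEquiv : TriIdx (P := P) c u₀ ≃ TriIdx (P := P) c u₀ :=
  Equiv.ofBijective _ (Finite.injective_iff_bijective.1 (σ.phiTri_injective hl hc hcl hP hL h12 hq hf hcu₀ hu₀))

/-- **The `FlagTenOrbitData` of a plane** (Step E): `φ, γ, C, β` read off the plane and transported to `Fin` types. -/
noncomputable def flagTenDataOfPlane : FlagTenOrbitData :=
  { φ := ((eTri h12 hcu₀).trans (σ.phiEquiv hl hc hcl hP hL h12 hq hf hcu₀ hu₀)).trans (eTri h12 hcu₀).symm
    γ := fun j i => (σ.eOrbOn hc hcl hP hL h12 hq (σ.eFixL hl hc hf j)).symm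
      ⟨σ.gammaOrb l c (σ.eFixL hl hc hf j).1 (eTri h12 hcu₀ i).1,
        (σ.gammaOrb_mem hl hc hP hL (σ.exterior_of_mem_cline hL hcu₀ hu₀ (eTri h12 hcu₀ i).2.1 (eTri h12 hcu₀ i).2.2)
          (σ.eFixL hl hc hf j).2.1).1⟩
    C := fun k i => (σ.eLOrb hl hcl hP hL h12 hq (σ.eFixP hl hc hf k)).symm
      ⟨σ.cOrb l (σ.eFixP hl hc hf k).1 (eTri h12 hcu₀ i).1,
        (σ.cOrb_mem hl hP (σ.exterior_of_mem_cline hL hcu₀ hu₀ (eTri h12 hcu₀ i).2.1 (eTri h12 hcu₀ i).2.2)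
          (σ.eFixP hl hc hf k).2.1).1⟩
    β := fun k j t => (σ.eOrbOn hc hcl hP hL h12 hq (σ.eFixL hl hc hf j)).symm
      ⟨σ.betaOrb c (σ.eFixL hl hc hf j).1 ((σ.eLOrb hl hcl hP hL h12 hq (σ.eFixP hl hc hf k)) t).1, by
        obtain ⟨b, hb, hbeq⟩ := mem_image.1 ((σ.eLOrb hl hcl hP hL h12 hq (σ.eFixP hl hc hf k)) t).2
        rw [mem_filter] at hb
        rw [← hbeq]
        exact σ.betaOrb_mem hc hcl hP hL hq (σ.eFixP hl hc hf k).2.1 (σ.eFixP hl hc hf k).2.2 hb.2.1 hb.2.2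
          (σ.eFixL hl hc hf j).2.1 (σ.eFixL hl hc hf j).2.2⟩ }

/-! ### Conjuncts 1 and 4 of `IsFlagTenOrbitMatrix` for the transported data -/

/-- **Conjunct 1:** `φ` has no fixed point and no 2-cycle. -/
theorem flagTenDataOfPlane_phi (i : Fin 12) :
    (σ.flagTenDataOfPlane hl hc hcl hP hL h12 hq hf hcu₀ hu₀).φ i ≠ i ∧
      (σ.flagTenDataOfPlane hl hc hcl hP hL h12 hq hf hcu₀ hu₀).φ ((σ.flagTenDataOfPlane hl hc hcl hP hL h12 hq hf hcu₀ hu₀).φ i) ≠ i := by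
  set e := eTri (P := P) h12 hcu₀ with he
  set Φ := σ.phiEquiv hl hc hcl hP hL h12 hq hf hcu₀ hu₀ with hΦ
  have hφ : (σ.flagTenDataOfPlane hl hc hcl hP hL h12 hq hf hcu₀ hu₀).φ = (e.trans Φ).trans e.symm := rfl
  have hΦv : ∀ x : TriIdx (P := P) c u₀, (Φ x).1 = σ.phiVertex l c u₀ x.1 := fun x => rfl
  set x := e i with hx
  have hxX := σ.exterior_of_mem_cline hL hcu₀ hu₀ x.2.1 x.2.2
  rw [hφ]
  constructor
  · intro h1
    have h2 : Φ x = x := by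
      have := congrArg e h1
      simpa [Equiv.trans_apply, Equiv.apply_symm_apply] using this
    have h3 : σ.phiVertex l c u₀ x.1 = x.1 := by rw [← hΦv]; exact congrArg Subtype.val h2
    have hne := (σ.phiVertex_spec hl hc hcl hP hL h12 hq hf hcu₀ hu₀ hxX).2.2.2
    exact hne (by rw [h3])
  · intro h1
    have h2 : Φ (Φ x) = x := by
      have := congrArg e h1
      simpa [Equiv.trans_apply, Equiv.apply_symm_apply, Equiv.symm_apply_apply] using this
    have h3 : σ.phiVertex l c u₀ (σ.phiVertex l c u₀ x.1) = x.1 := by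
      have := congrArg Subtype.val h2
      rw [hΦv, hΦv] at this; exact this
    exact σ.phiVertex_no_two_cycle hl hc hcl hP hL h12 hq hf hcu₀ hu₀ x.2.1 x.2.2 h3

/-- **Conjunct 4:** every `β k j` is a bijection of `Fin 4`. -/
theorem flagTenDataOfPlane_beta_bijective (k j : Fin 9) :
    Function.Bijective ((σ.flagTenDataOfPlane hl hc hcl hP hL h12 hq hf hcu₀ hu₀).β k j) := by
  apply (Finite.injective_iff_bijective).1
  intro t t' h
  set y := σ.eFixP hl hc hf k with hy
  set m := σ.eFixL hl hc hf j with hm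
  set eO := σ.eOrbOn hc hcl hP hL h12 hq m with heO
  set eB := σ.eLOrb hl hcl hP hL h12 hq y with heB
  -- unfold β: equal images under `eO.symm` ⇒ equal orbit values
  have hβ : ∀ s : Fin 4, ((σ.flagTenDataOfPlane hl hc hcl hP hL h12 hq hf hcu₀ hu₀).β k j s : Fin 4)
      = eO.symm ⟨σ.betaOrb c m.1 (eB s).1, by
          obtain ⟨b, hb, hbeq⟩ := mem_image.1 (eB s).2
          rw [mem_filter] at hb
          rw [← hbeq]
          exact σ.betaOrb_mem hc hcl hP hL hq y.2.1 y.2.2 hb.2.1 hb.2.2 m.2.1 m.2.2⟩ := fun s => rfl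
  rw [hβ, hβ] at h
  have hval : σ.betaOrb c m.1 (eB t).1 = σ.betaOrb c m.1 (eB t').1 := by
    have := congrArg Subtype.val (eO.symm.injective h); exact this
  -- both orbit values come from T-lines through y
  obtain ⟨b, hb, hbeq⟩ := mem_image.1 (eB t).2
  obtain ⟨b', hb', hb'eq⟩ := mem_image.1 (eB t').2
  rw [mem_filter] at hb hb'
  rw [← hbeq, ← hb'eq] at hval
  have horb := σ.betaOrb_injective hc hcl hP hL hq y.2.1 y.2.2 m.2.1 m.2.2 hb.2.1 hb.2.2 hb'.2.1 hb'.2.2 hval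
  -- orb3 b' = orb3 b ⇒ (eB t').1 = (eB t).1 ⇒ t' = t
  have : eB t = eB t' := Subtype.ext (by rw [← hbeq, ← hb'eq, horb])
  exact eB.injective this

end Data

end Flag

end Collineation

end Summit.Ventures.DiscreteObjects.PP12
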